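import Summits.Ventures.LatticeQCDFlow.Scaling.SwapAcceptanceGapSlope

/-!
HONEST FRAMING: exact (Metropolis-corrected) sampling algorithms for lattice gauge theory; figures
of merit are autocorrelation/cost numbers at stated couplings and volumes; no continuum-physics
claim.

# SwapAcceptanceStrictAnti — THE EXACT SWAP ACCEPTANCE IS STRICTLY DECREASING IN THE GAP UNLESS THE TEMPERING
# STATISTIC IS A.S. CONSTANT; HENCE THE RETUNE TARGET OF THE LADDER-TUNING STEP HAS EXACTLY ONE SOLUTION
# (row 22 `su3-ptbc`, GEN-9, ours; sequel of `SwapAcceptanceGapSlope`, closing the `NOT CLAIMED: strict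
# monotonicity` line of GEN-8's `SwapAcceptanceMonotone`)

Venture `LatticeQCDFlow` (cell pub-lqcd), topic `Scaling`; FANOUT row 22 (`su3-ptbc`, PTBC comparator arm E4).  NEW
WORK of the cell over GEN-9's `SwapAcceptanceGapSlope` (`swapAcc_eq_mgf_pairMin_div`, `measurable_pairMin`,
`pairMin_bounded`, `exists_gap_of_target`), GEN-8's `SwapAcceptanceMonotone` (`swapAcc_anti_right`, `swapAcc_mono_left`,
`swapAcc_self`, `swapAcc_neg`) and `SwapAcceptanceMinLaw`, lean-2's `SwapAcceptanceLaw` (`mgf_pos_of_bounded`,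
`mem_interior_integrableExpSet_of_bounded`, `integrable_exp_mul_of_bounded`, `isProbabilityMeasure_tilted_mul`) and
`Theory2.swapAcc_symm`; Mathlib: the identity principle `AnalyticOnNhd.eqOn_of_preconnected_of_frequently_eq`,
`analyticOnNhd_mgf`, `AnalyticOnNhd.div`, `integral_eq_iff_of_ae_le`, `Measure.ae_ae_of_ae_prod`, `Measure.prod_swap`,
`absolutelyContinuous_tilted`.  Nothing is cited as a fact; no numerics.

## What is proved (`μ` a probability measure, `X` bounded measurable, `μ_s := μ.tilted (s·X)`; "non-degenerate" =
## `∀ c, ¬ (X =ᵐ[μ] c)`)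

* `exists_ae_eq_const_of_ae_prod_le` — if `X x ≤ X y` for `(ν⊗ν)`-a.e. `(x, y)` then `X` is `ν`-a.e. constant (swap
  the product, Fubini, pick a point of the full-measure set).
* `exists_ae_eq_const_of_mgf_pairMin_eq` — if `E_{ν⊗ν}[e^{h·min(X₁,X₂)}] = E_ν[e^{hX}]` at some `h > 0` then `X` is
  `ν`-a.e. constant (`e^{h·min} ≤ e^{hX₁}` pointwise; equal integrals force a.e. equality).
* `analyticOnNhd_swapQuot` — the min-law quotient `Q(h) = mgf(min(X₁,X₂); μ_s⊗μ_s)(h)/mgf(X; μ_s)(h)` is real-analytic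
  on `ℝ` (it equals `swapAcc X μ s (s+h)` for `h ≥ 0`).
* **`swapAcc_gap_strictAntiOn`** — for non-degenerate `X`, `h ↦ swapAcc X μ s (s+h)` is STRICTLY antitone on `[0, ∞)`.
  Proof: it is antitone (GEN-8); were two gaps `a < b` to give the same value, `Q` would be constant on `[a, b]`,
  hence on `ℝ` by the identity principle, so `Q(b) = Q(0) = 1`, i.e. the two MGFs agree at `b > 0`, so `X` is
  `μ_s`-a.e. (hence `μ`-a.e., `μ ≪ μ_s`) constant — excluded.
* **`swapAcc_strictAnti_right`** (`s ≤ t < t′ ⇒ swapAcc s t′ < swapAcc s t`), **`swapAcc_lt_one`** (`s < t ⇒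
  swapAcc s t < 1`: a pair at positive gap never accepts surely), **`swapAcc_strictMono_left`** (`s′ < s ≤ t`),
  **`swapAcc_nested_strict`** (a strictly nested pair accepts strictly more often).
* **`existsUnique_gap_of_target`** — THE RETUNE STEP IS WELL POSED: for non-degenerate `X`, every horizon `H ≥ 0` and
  every target `a ∈ [swapAcc(s, s+H), 1]` there is EXACTLY ONE gap `h ≥ 0` with `swapAcc(s, s+h) = a` (existence by
  continuity + IVT from `SwapAcceptanceGapSlope`, uniqueness by strict monotonicity).

WHY (CARD-su3-ptbc §1.6).  The card tunes the boundary-coupling ladder by bisection on `c_{i+1}` at fixed `c_i` until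
the pair accepts `20 %` (tolerance `± 5 %`), and refines by inserting levels.  GEN-8 typed that the exact acceptance is
monotone in the gap and that nested pairs accept at least as often; this file adds STRICTNESS for every non-degenerate
tempering statistic — so the bisection target, when bracketed, determines the partner coupling UNIQUELY, and inserting
a level STRICTLY raises both new pair acceptances — with no Gaussian modelling step.  For PTBC the statistic is the
defect action `X = −S_D`, never a.s. constant at `β < ∞`.

Literature grade (cell rule): KNOWN MECHANISM (strict monotone likelihood ratio of an exponential family; every
adaptive-ladder recipe presumes a unique solution of "acceptance = target", e.g. Hukushima–Nemoto 1996,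
Katzgraber–Trebst–Huse–Troyer 2006), NEW TYPING (strictness at measure level for every bounded linear family via the
min law + identity principle; well-posedness of the retune target).  NOT CLAIMED: a rate (how fast the acceptance
falls — that is `SwapAcceptanceGapSlope`); the limit of the acceptance at infinite gap; anything about a run.
-/

noncomputable section

open MeasureTheory ProbabilityTheory Real Set Filter Topology

namespace Summit.Ventures.LatticeQCDFlow.Scaling

variable {Ω : Type*} [MeasurableSpace Ω] {μ : Measure Ω} [IsProbabilityMeasure μ] {X : Ω → ℝ}

/-- If `X x ≤ X y` for `(ν ⊗ ν)`-a.e. `(x, y)` (`ν ≠ 0` s-finite), then `X` is `ν`-a.e. constant. [folklore] -/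
theorem exists_ae_eq_const_of_ae_prod_le {ν : Measure Ω} [SFinite ν] [NeZero ν] (hXm : Measurable X)
    (h : ∀ᵐ z ∂(ν.prod ν), X z.1 ≤ X z.2) : ∃ c : ℝ, X =ᵐ[ν] fun _ => c := by
  have h1 : ∀ᵐ x ∂ν, ∀ᵐ y ∂ν, X x ≤ X y := Measure.ae_ae_of_ae_prod h
  have h2 : ∀ᵐ z ∂(ν.prod ν), X z.2 ≤ X z.1 := by
    have hmeas : MeasurableSet {z : Ω × Ω | X z.1 ≤ X z.2} :=
      measurableSet_le (hXm.comp measurable_fst) (hXm.comp measurable_snd)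
    have hswap : ∀ᵐ z ∂((ν.prod ν).map Prod.swap), X z.1 ≤ X z.2 := by
      rw [Measure.prod_swap]; exact h
    exact (ae_map_iff measurable_swap.aemeasurable hmeas).1 hswap
  have h2' : ∀ᵐ x ∂ν, ∀ᵐ y ∂ν, X y ≤ X x := Measure.ae_ae_of_ae_prod h2
  have h3 : ∀ᵐ x ∂ν, ∀ᵐ y ∂ν, X y = X x := by
    filter_upwards [h1, h2'] with x hx hx'
    filter_upwards [hx, hx'] with y hy hy'
    exact le_antisymm hy' hy
  obtain ⟨x₀, hx₀⟩ := h3.exists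
  exact ⟨X x₀, hx₀⟩

/-- If the exponential moment of the pair minimum equals that of one copy at some `h > 0`,
`E_{ν⊗ν}[e^{h·min(X₁,X₂)}] = E_ν[e^{hX}]`, then `X` is `ν`-a.e. constant (`e^{h·min(X₁,X₂)} ≤ e^{hX₁}` pointwise,
so equality of the integrals forces `X₁ ≤ X₂` a.e.). [ours] -/
theorem exists_ae_eq_const_of_mgf_pairMin_eq {ν : Measure Ω} [IsProbabilityMeasure ν] (hXm : Measurable X)
    (hXb : ∃ C, ∀ ω, |X ω| ≤ C) {h : ℝ} (hh : 0 < h)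
    (heq : mgf (fun z : Ω × Ω => min (X z.1) (X z.2)) (ν.prod ν) h = mgf X ν h) :
    ∃ c : ℝ, X =ᵐ[ν] fun _ => c := by
  have hYm : Measurable fun z : Ω × Ω => min (X z.1) (X z.2) := measurable_pairMin hXm
  obtain ⟨C', hC'⟩ := pairMin_bounded (X := X) hXb
  obtain ⟨C, hC⟩ := hXb
  -- the one-copy moment as a product integral
  have h1 : mgf X ν h = ∫ z, exp (h * X z.1) ∂(ν.prod ν) := by
    have hp := integral_prod_mul (μ := ν) (ν := ν) (fun x => exp (h * X x)) (fun _ => (1 : ℝ))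
    simp only [mul_one, integral_const, smul_eq_mul, probReal_univ] at hp
    rw [hp]; rfl
  have hf : Integrable (fun z : Ω × Ω => exp (h * min (X z.1) (X z.2))) (ν.prod ν) :=
    integrable_exp_mul_of_bounded hYm ⟨C', hC'⟩ h
  have hg : Integrable (fun z : Ω × Ω => exp (h * X z.1)) (ν.prod ν) :=
    integrable_exp_mul_of_bounded (hXm.comp measurable_fst) ⟨C, fun z => hC z.1⟩ h
  have hle : (fun z : Ω × Ω => exp (h * min (X z.1) (X z.2))) ≤ᵐ[ν.prod ν] fun z => exp (h * X z.1) :=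
    ae_of_all _ fun z => exp_le_exp.2 (mul_le_mul_of_nonneg_left (min_le_left _ _) hh.le)
  have hint : ∫ z, exp (h * min (X z.1) (X z.2)) ∂(ν.prod ν) = ∫ z, exp (h * X z.1) ∂(ν.prod ν) := by
    rw [← h1]; exact heq
  have hae := (integral_eq_iff_of_ae_le hf hg hle).1 hint
  refine exists_ae_eq_const_of_ae_prod_le (ν := ν) hXm ?_
  filter_upwards [hae] with z hz
  have hz' : h * min (X z.1) (X z.2) = h * X z.1 := exp_injective hz
  have hmin : min (X z.1) (X z.2) = X z.1 := mul_left_cancel₀ hh.ne' hz'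
  exact min_eq_left_iff.1 hmin

/-- The analytic extension of the gap profile: `Q(h) = mgf(min(X₁,X₂); μ_s⊗μ_s)(h) / mgf(X; μ_s)(h)` is real-analytic
on all of `ℝ` (it agrees with `h ↦ swapAcc X μ s (s+h)` on `[0, ∞)` by the min law). [ours] -/
theorem analyticOnNhd_swapQuot (hXm : Measurable X) (hXb : ∃ C, ∀ ω, |X ω| ≤ C) (s : ℝ) :
    AnalyticOnNhd ℝ (fun h => mgf (fun z : Ω × Ω => min (X z.1) (X z.2))
        ((μ.tilted fun ω => s * X ω).prod (μ.tilted fun ω => s * X ω)) h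
          / mgf X (μ.tilted fun ω => s * X ω) h) univ := by
  set μs : Measure Ω := μ.tilted fun ω => s * X ω with hμs
  haveI : IsProbabilityMeasure μs := isProbabilityMeasure_tilted_mul hXm hXb s
  have hYm : Measurable fun z : Ω × Ω => min (X z.1) (X z.2) := measurable_pairMin hXm
  have hYb := pairMin_bounded (X := X) hXb
  refine AnalyticOnNhd.div (fun h _ => ?_) (fun h _ => ?_) fun h _ => (mgf_pos_of_bounded hXm hXb h).ne'
  · exact analyticOnNhd_mgf h (mem_interior_integrableExpSet_of_bounded hYm hYb h)
  · exact analyticOnNhd_mgf h (mem_interior_integrableExpSet_of_bounded hXm hXb h)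

/-- **THE EXACT SWAP ACCEPTANCE IS STRICTLY DECREASING IN THE GAP UNLESS THE TEMPERING STATISTIC IS A.S.
CONSTANT.**  For a bounded measurable `X` that is not `μ`-a.e. constant, `h ↦ swapAcc X μ s (s + h)` is strictly
antitone on `[0, ∞)`.  (Antitone by GEN-8; if two gaps gave the same acceptance the analytic extension would be
constant on an interval, hence everywhere by the identity principle, hence `swapAcc = 1` at a positive gap, which
forces `min(X₁,X₂) = X₁` a.e., i.e. `X` a.e. constant.) [ours] -/
theorem swapAcc_gap_strictAntiOn (hXm : Measurable X) (hXb : ∃ C, ∀ ω, |X ω| ≤ C)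
    (hnd : ∀ c : ℝ, ¬ (X =ᵐ[μ] fun _ => c)) (s : ℝ) :
    StrictAntiOn (fun h => swapAcc X μ s (s + h)) (Ici 0) := by
  set μs : Measure Ω := μ.tilted fun ω => s * X ω with hμs
  haveI : IsProbabilityMeasure μs := isProbabilityMeasure_tilted_mul hXm hXb s
  set Y : Ω × Ω → ℝ := fun z => min (X z.1) (X z.2) with hY
  set Q : ℝ → ℝ := fun h => mgf Y (μs.prod μs) h / mgf X μs h with hQ
  set A : ℝ → ℝ := fun h => swapAcc X μ s (s + h) with hA
  have hAQ : ∀ h, 0 ≤ h → A h = Q h := fun h hh => swapAcc_eq_mgf_pairMin_div hXm hXb s hh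
  have hanti : AntitoneOn A (Ici 0) := by
    intro a ha b _ hab
    exact swapAcc_anti_right hXm hXb (by simpa using ha) (by linarith)
  -- strictness by contradiction
  intro a ha b hb hab
  rcases (hanti ha hb hab.le).lt_or_eq with hlt | heq
  · exact hlt
  exfalso
  have ha0 : 0 ≤ a := ha
  have hb0 : 0 < b := lt_of_le_of_lt ha0 hab
  -- `A` is constant `= A a` on `[a, b]`, hence `Q` is
  have hconst : ∀ h ∈ Icc a b, Q h = A a := by
    intro h hh
    have h0 : 0 ≤ h := ha0.trans hh.1
    rw [← hAQ h h0]
    refine le_antisymm (hanti ha (show h ∈ Ici 0 from h0) hh.1) ?_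
    rw [← heq]
    exact hanti (show h ∈ Ici 0 from h0) hb hh.2
  -- identity principle at the midpoint
  have hQan := analyticOnNhd_swapQuot (μ := μ) hXm hXb s
  set m : ℝ := (a + b) / 2 with hm
  have hfreq : ∃ᶠ z in 𝓝[≠] m, Q z = (fun _ => A a) z := by
    have hev : ∀ᶠ z in 𝓝[≠] m, Q z = A a := by
      have hIoo : Ioo a b ∈ 𝓝 m := Ioo_mem_nhds (by rw [hm]; linarith) (by rw [hm]; linarith)
      filter_upwards [nhdsWithin_le_nhds hIoo] with z hz
      exact hconst z (Ioo_subset_Icc_self hz)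
    exact hev.frequently
  have hQeq : EqOn Q (fun _ => A a) univ :=
    hQan.eqOn_of_preconnected_of_frequently_eq analyticOnNhd_const isPreconnected_univ (mem_univ m) hfreq
  -- at `0`: `Q 0 = A 0 = 1`, so `A a = 1`, so `Q b = 1`
  have hQ0 : Q 0 = 1 := by rw [← hAQ 0 le_rfl, hA]; simp only [add_zero]; exact swapAcc_self hXm hXb s
  have hAa : A a = 1 := by rw [← hQ0]; exact (hQeq (mem_univ 0)).symm
  have hQb : Q b = 1 := by rw [hQeq (mem_univ b)]; exact hAa
  -- `Q b = 1` means the two MGFs agree at `b > 0`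
  have hD : mgf X μs b ≠ 0 := (mgf_pos_of_bounded hXm hXb b).ne'
  have hmgf : mgf Y (μs.prod μs) b = mgf X μs b := by
    have := hQb
    rw [hQ] at this
    simpa [div_eq_one_iff_eq hD] using this
  obtain ⟨c, hc⟩ := exists_ae_eq_const_of_mgf_pairMin_eq (ν := μs) hXm hXb hb0 hmgf
  -- transfer the a.e. statement from `μ_s` back to `μ`
  have hac : μ ≪ μs := absolutelyContinuous_tilted (integrable_exp_mul_of_bounded hXm hXb s)
  exact hnd c (hac.ae_le hc)

/-- **Strict form of GEN-8's `swapAcc_anti_right`**: for `s ≤ t < t′` and `X` not a.e. constant,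
`swapAcc X μ s t′ < swapAcc X μ s t`. [ours] -/
theorem swapAcc_strictAnti_right (hXm : Measurable X) (hXb : ∃ C, ∀ ω, |X ω| ≤ C)
    (hnd : ∀ c : ℝ, ¬ (X =ᵐ[μ] fun _ => c)) {s t t' : ℝ} (hst : s ≤ t) (htt' : t < t') :
    swapAcc X μ s t' < swapAcc X μ s t := by
  have h := swapAcc_gap_strictAntiOn (μ := μ) hXm hXb hnd s (show t - s ∈ Ici 0 from sub_nonneg.2 hst)
    (show t' - s ∈ Ici 0 from sub_nonneg.2 (hst.trans htt'.le)) (by linarith)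
  simpa only [add_sub_cancel] using h

/-- **A pair at positive gap never accepts surely**: for `s < t` and `X` not a.e. constant, `swapAcc X μ s t < 1`.
[ours] -/
theorem swapAcc_lt_one (hXm : Measurable X) (hXb : ∃ C, ∀ ω, |X ω| ≤ C)
    (hnd : ∀ c : ℝ, ¬ (X =ᵐ[μ] fun _ => c)) {s t : ℝ} (hst : s < t) : swapAcc X μ s t < 1 := by
  have h := swapAcc_strictAnti_right (μ := μ) hXm hXb hnd le_rfl hst
  rwa [swapAcc_self hXm hXb s] at h

/-- **Strict form of `swapAcc_mono_left`**: for `s′ < s ≤ t`, `swapAcc X μ s′ t < swapAcc X μ s t`. [ours] -/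
theorem swapAcc_strictMono_left (hXm : Measurable X) (hXb : ∃ C, ∀ ω, |X ω| ≤ C)
    (hnd : ∀ c : ℝ, ¬ (X =ᵐ[μ] fun _ => c)) {s' s t : ℝ} (hs's : s' < s) (hst : s ≤ t) :
    swapAcc X μ s' t < swapAcc X μ s t := by
  have hXm' : Measurable fun ω => -X ω := hXm.neg
  have hXb' : ∃ C, ∀ ω, |(fun ω => -X ω) ω| ≤ C := by
    obtain ⟨C, hC⟩ := hXb; exact ⟨C, fun ω => by simpa only [abs_neg] using hC ω⟩
  have hnd' : ∀ c : ℝ, ¬ ((fun ω => -X ω) =ᵐ[μ] fun _ => c) := by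
    intro c hc
    refine hnd (-c) ?_
    filter_upwards [hc] with ω hω
    have : -X ω = c := hω
    linarith
  rw [Theory2.swapAcc_symm s' t, Theory2.swapAcc_symm s t, ← swapAcc_neg t s', ← swapAcc_neg t s]
  exact swapAcc_strictAnti_right hXm' hXb' hnd' (neg_le_neg hst) (neg_lt_neg hs's)

/-- **A strictly nested pair accepts strictly more often**: `s ≤ a ≤ b ≤ t` with `(a, b) ≠ (s, t)` gives
`swapAcc X μ s t < swapAcc X μ a b`. [ours] -/
theorem swapAcc_nested_strict (hXm : Measurable X) (hXb : ∃ C, ∀ ω, |X ω| ≤ C)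
    (hnd : ∀ c : ℝ, ¬ (X =ᵐ[μ] fun _ => c)) {s a b t : ℝ} (hsa : s ≤ a) (hab : a ≤ b) (hbt : b ≤ t)
    (hne : s < a ∨ b < t) : swapAcc X μ s t < swapAcc X μ a b := by
  rcases hne with h | h
  · calc swapAcc X μ s t ≤ swapAcc X μ s b := swapAcc_anti_right hXm hXb (hsa.trans hab) hbt
      _ < swapAcc X μ a b := swapAcc_strictMono_left hXm hXb hnd h hab
  · calc swapAcc X μ s t < swapAcc X μ s b := swapAcc_strictAnti_right hXm hXb hnd (hsa.trans hab) h
      _ ≤ swapAcc X μ a b := swapAcc_mono_left hXm hXb hsa hab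

/-- **THE RETUNE TARGET HAS EXACTLY ONE SOLUTION** (CARD §1.6 bisection, exact setting): for `X` not a.e. constant,
every horizon `H ≥ 0` and every target `a ∈ [swapAcc(s, s+H), 1]` there is a UNIQUE gap `h ≥ 0` with
`swapAcc(s, s+h) = a` (existence: `exists_gap_of_target`; uniqueness: strict monotonicity), and it lies in `[0, H]`.
[ours] -/
theorem existsUnique_gap_of_target (hXm : Measurable X) (hXb : ∃ C, ∀ ω, |X ω| ≤ C)
    (hnd : ∀ c : ℝ, ¬ (X =ᵐ[μ] fun _ => c)) (s : ℝ) {H a : ℝ} (hH : 0 ≤ H)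
    (ha : a ∈ Icc (swapAcc X μ s (s + H)) 1) : ∃! h : ℝ, 0 ≤ h ∧ swapAcc X μ s (s + h) = a := by
  obtain ⟨h, hh, hha⟩ := exists_gap_of_target hXm hXb s hH ha
  refine ⟨h, ⟨hh.1, hha⟩, fun h' hh' => ?_⟩
  have hinj := (swapAcc_gap_strictAntiOn (μ := μ) hXm hXb hnd s).injOn
  exact hinj (show h' ∈ Ici 0 from hh'.1) (show h ∈ Ici 0 from hh.1) (hh'.2.trans hha.symm)

end Summit.Ventures.LatticeQCDFlow.Scaling

end
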